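import Mathlib
import HarnessLib
import HarnessLib.Audit
import Summits.HodgeConjecture.Statement
import Literature.AlgebraicGeometry.Motives.FamiliesVHS
import Literature.AlgebraicGeometry.Motives.Sweep1
import Literature.AlgebraicGeometry.HodgeTheory.HodgeModelExistence
import Literature.AlgebraicGeometry.HodgeTheory.GysinFormalism
import Literature.AlgebraicGeometry.HodgeTheory.GysinFormalismCorrespondences
import Summits.HodgeConjecture.HodgeConjecture.Theorems.NodalSupportHodgeModels
import Literature.AlgebraicGeometry.HodgeTheory.HodgeLocus
import HarnessLib.Audit.Status.Attr

/-!
Route: KuznetsovCYFactory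

DORMANT since 2026-08-27T15:03:45Z (reconciler: no traction for 5 d (last activity item-evidence-added at 2026-08-22T13:00:44Z); parked, not closed — `ledger route dormant route-HodgeConjecture-KuznetsovCYFactory --off` to reactivate) — unstaffed, not closed; items shared with open routes are served there. `ledger route dormant <id> --off` reactivates.

# Route KuznetsovCYFactory — HodgeConjecture (planner plancard 2026-08-15; route-choice repair
2026-08-16; idea card kuznetsov-stability-cycle-factory)

## Thesis X (it suffices to show X = VariationalHodgeSmooth ∧ AnchorExistence)
ANCHOR + TRANSPORT, on the frame SHARED VERBATIM with route AnchorTransport (items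
stmt-HodgeConjecture-1076 / 1077 — one item, one
staffing; the two decls of this file are rfl-equal to AnchorTransport.VariationalHodge /
AnchorTransport.AnchorExistence).
(V) VariationalHodgeSmooth = Grothendieck's variational Hodge conjecture, global-class form: for
every smooth projective family
f : 𝒳 ⟶ S over ℂ (Literature.AlgebraicGeometry.Motives.IsSmoothProjectiveFamily f n) over a SMOOTH
IRREDUCIBLE base S and every class
A ∈ H^{2p}(𝒳(ℂ); ℂ) whose restrictions complexBetti.map (fiberι f s) A to all fibres 𝒳_s = fiberOver
f s are RATIONAL of Hodge type
(p,p): A|𝒳_{s₀} algebraic for one s₀ ⇒ A|𝒳_s algebraic for every s (CharlesSchnell2014Notes Conj.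
11.3.1 = Grothendieck1966 fn. 13;
HC ⇒ V, Cor. 11.3.6). (An) AnchorExistence: every rational (p,p)-class c on a smooth projective X is
e^*(A|𝒳_{s₁}) for such a datum
(f, A), an iso e : X ≅ 𝒳_{s₁} and a fibre s₀ where A is ALGEBRAIC ("every Hodge-locus component
contains an algebraic point"; the
constant family is allowed, so HC ⇒ An).
Lean: `VariationalHodgeSmooth ∧ AnchorExistence` (decls of this file; carriers complexBetti X i =
singularCohomology ℂ ℂ (ComplexPoints X) i,
complexBetti.map f i = singularCohomology.map of AlgPoints.mapContinuous f, fiberOver / fiberι,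
algebraicClasses — real definitions of the tree).
X ⇔ HodgeConjecture: HC ⇒ V, An trivially; V ∧ An ⇒ HC is the DECIDING THEOREM `closes` (rev 10,
CRUX-ONLY:
closes (hV : VariationalHodgeSmooth) (hAn : AnchorExistence) (hM : HodgeModels) : HodgeConjecture —
pure logic; iso-invariance of
algebraicClasses along e : X ≅ 𝒳_{s₁} is proved INLINE (isomorphisms are open immersions,
codimension of points is preserved); the
anti-vacuity conjunct Nonempty (HodgeModel n X) is the crux HodgeModels = named fact
nonempty_hodgeModel; native rc 0, axioms
propext/Classical.choice/Quot.sound); the item `Assembly` records the chain HodgeModels →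
AlgebraicClassesIsoInvariant →
VariationalHodgeSmooth → AnchorExistence → HodgeConjecture (one instantiation of closes' inline
argument discharges its extra antecedent).
REPAIR 2026-08-16 (operator hold route.target-unreachable): the route's own UNSTAFFED frame targets
VariationalHodge / AnchorCompleteness
(stmt-1878/1879: arbitrary base with connected S(ℂ) and a globally rational α — the same two
conjectures up to phrasing, refuter review
729bda87; the opener's rev-1 note already asked for this dedup) were dropped for the shared, staffed
cruxes; the stratum content is unchanged.
The frame is the common skeleton of every anchor-and-transport attack; THIS route's content is the
stratum it attacks first and the engine:

## The stratum: Calabi–Yau-type Kuznetsov components of Fano hypersurfaces (d | n+2), level 4 first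
For X_d ⊂ ℙ^{n+1} smooth with d | n+2, Ku(X) = ⟨O_X,…,O_X(n+1−d)⟩^⊥ ⊂ D^b(X) is a Calabi–Yau
category of dimension k = (n+2)(d−2)/d
(Kuznetsov2017), and HC(X) ⇔ noncommutative HC(Ku(X)) (Perry2022 §5, Lemma 5.20; exceptional objects
carry algebraic classes).
k = 2 (cubic fourfolds; GM) is THEOREM territory (BayerEtAl2021, Perry2022) but rationally already
known (Zucker1977CubicFourfolds,
Conte–Murre/BlochSrinivas1983). The first strata where HC is OPEN and the middle Hodge structure has
level 4 — beyond every cylinder /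
coniveau method (Terasoma1990: generic cubic 8-folds, level 2; Shimada2003VanishingCyclesGHC tables
stop at n ≤ 9) — are exactly the
CY₄-component Fano hypersurfaces: CUBIC TENFOLDS (h^{7,3}, h^{6,4}, h^{5,5}_prim = 1, 220, 924) and
QUARTIC SIXFOLDS (h^{5,1} = 1).
Cruxes: CubicTenfoldTransport (rank 2) = the cubic-tenfold stratum of V, p = 5, and
CubicTenfoldAnchors (rank 3) = the cubic-tenfold
stratum of An (both phrased over an arbitrary base with connected complex points and a GLOBALLY
rational class — same truth value as the
smooth-irreducible-base / fibrewise-rational phrasing of the frame by the theorem of the fixed part,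
refuter review 729bda87; vetted 3/3);
QuarticSixfoldMiddleHC (rank 4) = the whole second stratum; VariationalHodgeSmooth (rank 5) and
AnchorExistence (rank 6) = the shared frame. Glue `CubicTenfoldHC` (support, pure logic, proved in
sketch):
Transport → Anchors → HypersurfaceOffMiddleHC (Lefschetz package, known) → HC for all smooth cubic
tenfolds.

## Engine (informal; no Lean vocabulary yet — definition requests filed)
Transport = noncommutative variational Hodge (Perry2022 Conj. 5.21) for the CY₄ category Ku(X) over
the Hodge locus: relative moduli of
objects in Ku(𝒳/S) (Lieblich), (−2)-shifted symplectic (BravDyckerhoff2021, PTVV),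
Oh–Thomas/Borisov–Joyce virtual class (OhThomas2023)
REDUCED along the Hodge locus of v à la Bae–Kool–Park (arXiv:2208.09474, CY₄ varieties): a non-zero
categorical DT₄ count at one member
certifies v on the whole Hodge-locus component — the k = 4 replacement for Mukai–Yoshioka
non-emptiness / Perry's smoothness criterion
(Prop. 8.1), which is what makes k = 2 work. Anchors = Fermat members (HC known in prime degree 3
and degree 4 ≤ 20: Ran1980,
Shioda1979HodgeFermat; Ku(Fermat cubic) = graded matrix factorisations of Σ xᵢ³ with μ₃¹²⋊S₁₂
symmetry, torus-localisable counts) and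
cubics/quartics containing linear or complete-intersection half-dimensional subvarieties.

Rationale: WHY THIS LINE. Perry2022 (read: Thm 1.1/1.3/1.4, Prop 8.1, Conj 5.21) isolates why the categorical
proofs of (integral) HC for cubic/GM
fourfolds work: objects of a CY₂ category deform unobstructedly along the Hodge locus of their class
(noncommutative Bloch semiregularity),
and asks explicitly to "apply this method to varieties whose Kuznetsov components are not CY2
categories". For CY₄ components the
unobstructedness is false but a VIRTUAL substitute now exists (OhThomas2023, Borisov–Joyce,
BravDyckerhoff2021 for moduli of objects,
Bae–Kool–Park arXiv:2208.09474 reduced classes along Hodge loci ⇒ variational HC instances on CY₄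
varieties). Imported area: derived
categories / enumerative DT₄ theory into Hodge theory of Fano hypersurfaces. The typed cruxes are
the honest cohomological shadows
(VHC + anchors for cubic tenfolds; middle HC for quartic sixfolds) over the tree's real
singular-cohomology vocabulary; the categorical
layer rides in the informal text until `KuznetsovComponent`/topological K-theory notions land
(definition request filed).
RANKED CRUXES. #2 CubicTenfoldTransport — hardest/most informative: VHC for degree-10 classes in
connected families of smooth cubic
tenfolds (the cubic-tenfold stratum of V; engine = reduced categorical DT₄ on the CY₄ Kuznetsov
component). #3 CubicTenfoldAnchors — every
(X, c) connects inside a family of cubic tenfolds, through a global rational fibrewise-(5,5) class,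
to a fibre where the class is algebraic
(rigid classes: the family may be constant, then it is HC at that point). #4 QuarticSixfoldMiddleHC
— rational (3,3)-classes on smooth
quartic sixfolds are algebraic (second CY₄ stratum, not yet decomposed). #5 VariationalHodgeSmooth —
the SHARED frame crux V (verbatim
AnchorTransport stmt-1076; one item, staffed once for both routes), load-bearing hypothesis of
`closes` (why it might fail: V ⇐ HC, so false
only with HC, but every known engine is partial — semiregular lci cycles, formal BEK2014, Perry's
CY₂ smoothness criterion, non-zero DT₄
counts). #6 AnchorExistence — the SHARED frame crux An (verbatim AnchorTransport stmt-1077),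
load-bearing in `closes` (fails strategically at
rigid classes whose Hodge-locus component meets no member with algebraicity known;
BaldiKlinglerUllmo2024 sparsity). #7 (recorded rank 9, last)
HodgeModels — the named fact nonempty_hodgeModel: conjunct 1 Nonempty (HodgeModel n X) of
HodgeConjectureFor (IsOfHodgeType := ∃ A : HodgeModel n X, …,
so no class hypothesis supplies a model); the third hypothesis of `closes`, shared verbatim by ten
routes, re-badged CRUX 2026-08-16 under the
crux-only rule (why it might fail: a theorem — GAGA, de Rham, Hodge decomposition — false only AS
STATED, i.e. a mis-specified HodgeModel
field; formally XL, reduction in tree: HodgeModelExistenceDischarge, leaves exists_deRhamIsoFamily /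
isInternal_hodgePQ). needs-fact:
Literature.AlgebraicGeometry.HodgeTheory.nonempty_hodgeModel — the only unproved Literature fact
left in the route file's import closure.
SUPPORT: HypersurfaceOffMiddleHC (weak + hard Lefschetz: off-middle classes on hypersurfaces are
multiples of hᵖ; known),
AlgebraicClassesIsoInvariant (API lemma; antecedent of CubicTenfoldHC; its content is proved inline
in closes — provable now verbatim as in
Theorems/AnchorTransportIsoInvariance.lean), CubicTenfoldHC (glue, pure logic), FermatPrimeDegreeHC
(Ran1980/Shioda1979HodgeFermat:
the anchor; known), Assembly (restated 2026-08-16 onto the shared frame; = closes with one extra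
antecedent).
KILL CRITERIA. (i) A theorem that DT₄-type counts of objects of Ku(X) vanish identically for every
non-trivial Hodge vector (cosection /
symmetry) retires the engine: close `exhausted` unless a prover has meanwhile advanced #2 by other
means. (ii) Refutation of #3 or #6 in Lean
(a Hodge class admitting no anchored family — with the constant family allowed this is ¬HC) refutes
HC itself — not expected; a refuter
SHOULD instead attack the informal strengthening "every Hodge-locus component of a (5,5)-class
passes through a cubic containing two
disjoint ℙ⁵'s or the Fermat point" and record the census. (iii) #4 refuted ⇒ drop the quartic
stratum. (iv) The frame is shared: if
route AnchorTransport closes V and An first, this route closes by the same `closes` logic and its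
stratum cruxes are then true but moot
(different phrasing, no Lean corollary) — drop them; conversely a census showing every instance
proof of V needs HC on the target fibre
kills both routes as strategies.
NOT DECOMPOSED YET. The categorical statements (Ku(X) CY₄, nc-VHC, relative moduli, virtual/reduced
classes, the Fermat count) — no
vocabulary; quintic eightfolds (CY₆ component) and higher d | n+2 strata; GM / Debarre–Voisin (no
Grassmannian subschemes in tree); the
card's k = 2 census (integral HC — not this summit's statement); cubic sevenfolds (CY₃ component)
are irrelevant (odd middle degree). The base-reduction glue between the two
phrasings of V/An (connected S(ℂ) + global rationality, used by the stratum cruxes, vs smooth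
irreducible S + fibrewise rationality, used by
the shared frame: chain of smooth curves through two points + theorem of the fixed part) is
deliberately NOT filed — both phrasings are
implied by HC and nothing in `closes` needs the translation.
CHEAPEST FALSIFIER. Half of it runs on paper: the UNREDUCED categorical DT₄ class of the intended
engine (OhThomas2023 on the (−2)-shifted
symplectic moduli of objects, BravDyckerhoff2021) is deformation-invariant over the 220-dimensional
moduli of cubic tenfolds, while every
non-zero primitive (5,5)-class v stops being Hodge off a proper closed subset (its Hodge locus has
codimension rank(·P_v : R₃ → R₉) ≥ 1:
R₆ = R₃·R₃ and the pairing R₆ × R₆ → R₁₂ is perfect by Macaulay duality in the Jacobian ring, socle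
degree 12) — so, granted the deformation invariance the engine itself relies on, the
unreduced count of objects of Hodge vector v vanishes identically (the phenomenon that forces the
reduction in arXiv:2208.09474 for CY₄
varieties), and crux #2 has an engine ONLY IF a REDUCED class for objects of Ku(𝒳/S) along the
Hodge locus of v (the categorical analogue of arXiv:2208.09474) can be built. Cheapest kill, one
refuter session with arXiv:2208.09474
§§1–3 and OhThomas2023: exhibit a step of the Bae–Kool–Park reduction that uses the geometry of the
CY₄ VARIETY (beyond the derived moduli
stack, its shifted symplectic form and the Hodge locus in the base) and has no counterpart for
Ku(X); then kill criterion (i) closes the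
route `exhausted`. For the frame (#5, #6) nothing is cheap: both are implied by HC.
NUMBERS. moduli of cubic tenfolds has dimension C(14,3) − 144 = 220 = h^{6,4}, so Hodge loci of
(5,5)-classes have expected dimension
220 − rank(·P : R₃ → R₉) ∈ [0, 200] (Griffiths IVHS; 20 = codimension of cubics containing a fixed
ℙ⁵) — zero-dimensional components
(rigid classes) are where #3 is HC outright; Movasati–Villaflor (AljovinMovasatiVillaflor2019) is
the computable entry point at Fermat.

Novelty: DELTA: transplant the Bae–Kool–Park reduced-DT₄ certificate logic (arXiv:2208.09474, CY₄ VARIETIES)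
to the CY₄ CATEGORIES Ku(X) of FANO hypersurfaces —
cubic tenfolds and quartic sixfolds, identified here (via Terasoma1990 /
Shimada2003VanishingCyclesGHC) as the first open strata beyond cylinder methods
(level-4 middle Hodge structure) — with Fermat matrix-factorisation points as anchors; plus a typed
universal anchor-and-transport frame
(VariationalHodge ∧ AnchorCompleteness over the tree's real cohomology) whose cubic-tenfold stratum
glues by pure logic to HC for all smooth cubic
tenfolds. Nearest prior art: (1) Perry2022 (read §1, §5, §8: Thm 1.3 ncVHC for CY₂ categories via
smoothness of relative moduli, Prop 8.1, Conj 5.21;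
explicit open question 'apply to non-CY₂ Kuznetsov components') + BayerEtAl2021 — the k = 2 factory,
rationally known anyway (Zucker1977CubicFourfolds);
(2) arXiv:2208.09474 + OhThomas2023 + BravDyckerhoff2021 — DT₄ on CY₄ varieties / shifted symplectic
moduli of objects (card dt4-virtual-anchoring owns
the commutative sextic-fourfold case); (3) Kuznetsov2017 — Ku(X_d), d | n+2, is CY of dim
(n+2)(d−2)/d; (4) Terasoma1990 (zbl review; paywalled,
acq-01766) HC for generic cubic 8-folds, Shimada2003VanishingCyclesGHC (read §8) cylinder tables n ≤
9 — level-2 cases only. No paper using categorical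
DT₄ of Kuznetsov components for Hodge-theoretic ends and no HC claim for cubic tenfolds / quartic
sixfolds found. Searches 2026-08-15: lit read
arXiv:2004.0316  [refs: 2208.09474, 2004.03163, math/0311180, Terasoma1990, Perry2022, BayerEtAl2021, OhThomas2023, BravDyckerhoff2021, Kuznetsov2017]

Barriers (technique_class: kuznetsov-component, categorical-dt4, variational-hodge): technique_class: kuznetsov-component, categorical-dt4, variational-hodge
- Literature.Barriers.HodgeConjecture.Voisin2003_generalHypersurface_noIntegralClassInF (normal
functions / infinitesimal invariants on hypersurfaces):
  APPLIES IN SPIRIT — general members carry nothing detectable. Evasion: transport runs ALONG HODGE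
LOCI (special members, where the class exists by
  fiat) via (virtual) deformation invariance of moduli of objects in Ku(X), never through Jacobi
inversion or J = J_alg on hyperplane sections; the
  residue (rigid classes, 0-dimensional Hodge locus) is isolated in the anchor crux
CubicTenfoldAnchors.
- Literature.Barriers.HodgeConjecture.Voisin2002_weilTorus_hodgeClassWithoutSubvarieties and
Literature.Barriers.HodgeConjecture.Zucker1977_kaehlerTorus_noAnalyticCycles:
  EVADED by projectivity — classes arise as Chern characters of objects of D^b(X) on smooth
PROJECTIVE hypersurfaces (finite locally free
  resolutions + GAGA, the barrier's listed evasion); the SOD ⟨Ku(X), O_X(i)⟩ and moduli of objects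
use the ample O_X(1).
- Literature.Barriers.HodgeConjecture.AtiyahHirzebruch1962_torsionClass_notAlgebraic,
Literature.Barriers.HodgeConjecture.Kollar1992_nonTorsionClass_notAlgebraic:
  all items are ℚ-statements (IsRationalClass, ℂ-span algebraicClasses); a DT certificate may
realise only a multiple m·v — harmless rationally
  (Perry's integral k = 2 refinement is NOT claimed for k = 4).
- Literature.Barriers.HodgeConjecture.BlochSrinivas1983_hodgeTypeL0_vani

Novelty grade: new-combination — ROUTE REVIEW (refuter 729bda87, 3rd pass after e32c21a6/0dd483c9; confirms both). 11/11 decls rc0 (W_hodge.lean). Frame 1878/1879/1885/1880 = AnchorTransport 1076/1077/1078/1080 up to phrasing (connected S(C)+global rationality vs smooth irreducible S+fibrewise rationality; same truth value by the f (refuter refuter-rreview-route-CriticalPhenomena--729bda87-0, 2026-08-15T13:53:03Z; prior: Perry2022 arXiv:2004.03163 (ncVHC for CY2 categories; open question for non-CY2 Kuznetsov components), BaeKoolPark arXiv:2208.09474 (reduced DT4 along Hodge loci), OhThomas2023 / BravDyckerhoff2021, Kuznetsov2017 (Ku(X_d), d | n+2), Grothendieck1966 fn.13 / CharlesSchnell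 Conj 11.3.1 = route AnchorTransport stmt-1076/1077/1078, Ran1980, Shioda1979HodgeFermat (Fermat anchors), Terasoma1990, Shimada)

History (route lifecycle, newest last):
- 2026-08-16T03:31:50Z · rev 6: restated Assembly (stmt-HodgeConjecture-1880) — route-choice repair step 3/4: Assembly restated onto the shared frame (HodgeModels → AlgebraicClassesIsoInvariant → VariationalHodgeSmooth → AnchorExistence → H (planner-rchoice-HodgeConjecture-KuznetsovCYFac-ea4ff5a2-0)
- 2026-08-16T03:43:27Z · rev 7: dropped VariationalHodge, AnchorCompleteness — route-choice repair step 4/4 (operator hold route.target-unreachable): DROP the two unstaffed own-phrasing frame targets VariationalHodge (stmt-1878) and Anchor (planner-rchoice-HodgeConjecture-KuznetsovCYFac-ea4ff5a2-0)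
- 2026-08-27T15:03:45Z · DORMANT — reconciler: no traction for 5 d (last activity item-evidence-added at 2026-08-22T13:00:44Z); parked, not closed — `ledger route dormant route-HodgeConjecture-Ku (operator:999:2004355)

sub-problem: HodgeConjecture · status: dormant · opened planner-plancard-HodgeConjecture-HodgeConject-6f6ddb30-0 2026-08-15T10:59:23Z · rev 13 · ledger route-HodgeConjecture-KuznetsovCYFactory
GENERATED by the gate from the ledger (D-0016/17). Provers cite these decls: `theorem foo : Summit.HodgeConjecture.HodgeConjecture.Theses.KuznetsovCYFactory.<Decl> := …` in Summits/HodgeConjecture/HodgeConjecture/Theorems/<Name>.lean.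
-/

namespace Summit.HodgeConjecture.HodgeConjecture.Theses.KuznetsovCYFactory

open scoped BigOperators Topology Manifold Classical MeasureTheory ProbabilityTheory Matrix InnerProductSpace ComplexConjugate ContinuousMap
open Filter Set Function TopologicalSpace MeasureTheory

attribute [summit_statement] _root_.HodgeConjecture

/-- item stmt-HodgeConjecture-1881 · crux · rank 2 · open · by planner
why it might fail: Implied by HC but no engine one level up: Perry's smoothness criterion (Prop 8.1) fails for CY₄ categories (obstructed objects), a reduced DT₄ class for objects of Ku(𝒳/S) along Hodge loci is unbuilt (no stability conditions on CY₄ categories this size), and counts certify only non-zero classes.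
sources: Perry2022, arXiv:2208.09474, OhThomas2023, BravDyckerhoff2021, Kuznetsov2017, BayerEtAl2021
[crux] TRANSPORT for cubic tenfolds (Kuznetsov component CY₄: d = 3 | 12 = n+2, Kuznetsov2017): in a
smooth projective family all of whose fibres are smooth cubic tenfolds, over a base with connected
complex points, a rational global class of fibrewise type (5,5) that is algebraic on one fibre is
algebraic on every fibre (= VariationalHodge restricted to this stratum, p = 5). INTENDED ENGINE
(informal, no Lean vocabulary yet): noncommutative VHC (Perry2022 Conj. 5.21) for Ku(𝒳/S) via
relative moduli of objects (Lieblich), (−2)-shifted symplectic structure on moduli of objects of a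
CY₄ category (BravDyckerhoff2021/PTVV), Oh–Thomas/Borisov–Joyce virtual class REDUCED along the
Hodge locus of the class à la Bae–Kool–Park (arXiv:2208.09474): non-vanishing of the categorical DT₄
count at one member certifies the class on the whole component. H^{10}_prim of a cubic tenfold has
Hodge numbers (1, 220, 924, 220, 1): level 4, beyond cylinder/coniveau methods (Terasoma1990 level-2
cubic 8-folds; Shimada2003 tables n ≤ 9). -/
@[route_item "route-HodgeConjecture-KuznetsovCYFactory"]
def CubicTenfoldTransport : Prop :=
  ∀ (𝒳 S : Literature.AlgebraicGeometry.Motives.SchemeOver ℂ) (f : 𝒳 ⟶ S), Literature.AlgebraicGeometry.Motives.IsSmoothProjectiveFamily f 10 → ConnectedSpace (Literature.AlgebraicGeometry.Motives.ComplexPoints S) → (∀ s : Literature.AlgebraicGeometry.Motives.ComplexPoints S, Literature.AlgebraicGeometry.Motives.IsSmoothHypersurface 10 3 (Literature.AlgebraicGeometry.Motives.fiberOver f s)) → ∀ α : Literature.AlgebraicTopology.SingularHomology.singularCohomology ℂ ℂ (Literature.AlgebraicGeometry.Motives.ComplexPoints 𝒳) (2 * 5), Literature.AlgebraicGeometry.HodgeTheory.IsRationalClass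 α → (∀ s : Literature.AlgebraicGeometry.Motives.ComplexPoints S, Literature.AlgebraicGeometry.HodgeTheory.IsOfHodgeType 10 (Literature.AlgebraicGeometry.Motives.fiberOver f s) (2 * 5) 5 5 (Literature.AlgebraicTopology.SingularHomology.singularCohomology.map ℂ ℂ (Literature.AlgebraicGeometry.Motives.AlgPoints.mapContinuous (L := ℂ) (Literature.AlgebraicGeometry.Motives.fiberι f s)) (2 * 5) α)) → ∀ s₀ s₁ : Literature.AlgebraicGeometry.Motives.ComplexPoints S, Literature.AlgebraicTopology.SingularHomology.singularCohomology.map ℂ ℂ (Literature.AlgebraicGeometry.Motives.AlgPoints.mapContinuous (L := ℂ) (Literature.AlgebraicGeometry.Motives.fiberι f s₀)) (2 * 5) α ∈ Literature.AlgebraicGeometry.HodgeTheory.algebraicClasses (Literature.AlgebraicGeometry.Motives.fiberOver f s₀) 5 → Literature.AlgebraicTopology.SingularHomology.singularCohomology.map ℂ ℂ (Literature.AlgebraicGeometry.Motives.AlgPoints.mapContinuous (L := ℂ) (Literature.AlgebraicGeometry.Motives.fiberι f s₁)) (2 * 5) α ∈ Literature.AlgebraicGeometry.HodgeTheory.algebraicClasses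 (Literature.AlgebraicGeometry.Motives.fiberOver f s₁) 5

/-- item stmt-HodgeConjecture-1882 · crux · rank 3 · open · by planner
why it might fail: Hodge loci of (5,5)-classes can be 0-dimensional (IVHS rank up to 220 = dim moduli): at a rigid pair (X, c) off the Fermat / linear-cycle loci no deformation is available and the item is HC for that pair outright; no census of such rigid classes exists.
sources: AljovinMovasatiVillaflor2019, Shioda1979HodgeFermat, Ran1980, CattaniDeligneKaplan1995JAMS, Voisin2007HodgeLoci, VoisinHodgeII2003
[crux] ANCHORS for cubic tenfolds: every smooth cubic tenfold X with a rational (5,5)-class c lies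
in a family of smooth cubic tenfolds over a base with connected complex points, X ≅ a fibre,
carrying a global rational fibrewise-(5,5) class restricting to c on X and to an ALGEBRAIC class on
some fibre (= AnchorCompleteness on this stratum; with CubicTenfoldTransport and the Lefschetz
package it gives HC for all smooth cubic tenfolds by the glue item CubicTenfoldHC). Intended
anchors: the Fermat cubic Σxᵢ³ (HC known in prime degree: Ran1980, Shioda1979HodgeFermat; Hodge
classes spanned by linear ℙ⁵'s; Ku = graded matrix factorisations with μ₃¹²⋊S₁₂ symmetry — the
computable DT site), cubics containing two disjoint ℙ⁵'s or half-dimensional complete intersections,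
CM points. Moduli of cubic tenfolds has dim C(14,3) − 144 = 220 = h^{6,4}; the Hodge locus of a
(5,5)-class has dimension 220 − rk(·P_c : R₃ → R₉) (Griffiths IVHS in the Jacobian ring), anywhere
in [0, 200] (200 for the class of a ℙ⁵). A refuter should test the informal strengthening 'every
Hodge-locus component of a (5,5)-class passes through the Fermat point or a two-ℙ⁵ cubic' on
Aljovin–Movasati–Villaflor's components thr -/
@[route_item "route-HodgeConjecture-KuznetsovCYFactory"]
def CubicTenfoldAnchors : Prop :=
  ∀ (X : Literature.AlgebraicGeometry.Motives.SchemeOver ℂ), Literature.AlgebraicGeometry.Motives.IsSmoothHypersurface 10 3 X → ∀ (c : Literature.AlgebraicTopology.SingularHomology.singularCohomology ℂ ℂ (Literature.AlgebraicGeometry.Motives.ComplexPoints X) (2 * 5)), Literature.AlgebraicGeometry.HodgeTheory.IsRationalClass c → Literature.AlgebraicGeometry.HodgeTheory.IsOfHodgeType 10 X (2 * 5) 5 5 c → ∃ (𝒳 S : Literature.AlgebraicGeometry.Motives.SchemeOver ℂ) (f : 𝒳 ⟶ S) (s₀ s₁ : Literature.AlgebraicGeometry.Motives.ComplexPoints S)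 (e : X ≅ Literature.AlgebraicGeometry.Motives.fiberOver f s₁) (α : Literature.AlgebraicTopology.SingularHomology.singularCohomology ℂ ℂ (Literature.AlgebraicGeometry.Motives.ComplexPoints 𝒳) (2 * 5)), Literature.AlgebraicGeometry.Motives.IsSmoothProjectiveFamily f 10 ∧ ConnectedSpace (Literature.AlgebraicGeometry.Motives.ComplexPoints S) ∧ (∀ s : Literature.AlgebraicGeometry.Motives.ComplexPoints S, Literature.AlgebraicGeometry.Motives.IsSmoothHypersurface 10 3 (Literature.AlgebraicGeometry.Motives.fiberOver f s)) ∧ Literature.AlgebraicGeometry.HodgeTheory.IsRationalClass α ∧ (∀ s : Literature.AlgebraicGeometry.Motives.ComplexPoints S, Literature.AlgebraicGeometry.HodgeTheory.IsOfHodgeType 10 (Literature.AlgebraicGeometry.Motives.fiberOver f s) (2 * 5) 5 5 (Literature.AlgebraicTopology.SingularHomology.singularCohomology.map ℂ ℂ (Literature.AlgebraicGeometry.Motives.AlgPoints.mapContinuous (L := ℂ) (Literature.AlgebraicGeometry.Motives.fiberι f s)) (2 * 5) α)) ∧ Literature.AlgebraicTopology.SingularHomology.singularCohomology.map ℂ ℂ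 (Literature.AlgebraicGeometry.Motives.AlgPoints.mapContinuous (L := ℂ) e.hom) (2 * 5) (Literature.AlgebraicTopology.SingularHomology.singularCohomology.map ℂ ℂ (Literature.AlgebraicGeometry.Motives.AlgPoints.mapContinuous (L := ℂ) (Literature.AlgebraicGeometry.Motives.fiberι f s₁)) (2 * 5) α) = c ∧ Literature.AlgebraicTopology.SingularHomology.singularCohomology.map ℂ ℂ (Literature.AlgebraicGeometry.Motives.AlgPoints.mapContinuous (L := ℂ) (Literature.AlgebraicGeometry.Motives.fiberι f s₀)) (2 * 5) α ∈ Literature.AlgebraicGeometry.HodgeTheory.algebraicClasses (Literature.AlgebraicGeometry.Motives.fiberOver f s₀) 5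

/-- item stmt-HodgeConjecture-1883 · crux · rank 4 · open · by planner
why it might fail: Open; the only classical handle (cylinder of lines, Shimada k=1) reduces it to codimension-2 Hodge classes on a general-type 7-fold, themselves open; the categorical DT₄ engine on Ku(X) is unbuilt; could also simply be out of reach rather than false.
sources: Shimada2003VanishingCyclesGHC, Kuznetsov2017, Shioda1979HodgeFermat, Perry2022, arXiv:2208.09474
[crux] SECOND CY₄ STRATUM, whole: on a smooth quartic sixfold X ⊂ ℙ⁷ (d = 4 | 8 = n+2, Ku(X)
Calabi–Yau of dimension 4 by Kuznetsov2017; H⁶ of level 4: h^{5,1} = 1, h^{4,2}_prim = 266,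
h^{3,3}_prim = 1107) every rational (3,3)-class is algebraic. Same engine as the cubic stratum
(anchor = Fermat quartic, degree 4 ≤ 20: Shioda1979HodgeFermat; transport = reduced categorical DT₄
along Hodge loci); not decomposed into transport/anchor until the cubic cruxes show which half
moves. Lines give a surjective cylinder map H₄(F(X)) → H₆(X) for general X (Shimada, k = 1 case) but
it lands Hodge classes in degree-4 classes of the 7-fold F(X) of lines (K_F = 2H, general type),
where HC is open — the level-4 wall again. -/
@[route_item "route-HodgeConjecture-KuznetsovCYFactory"]
def QuarticSixfoldMiddleHC : Prop :=
  ∀ (X : Literature.AlgebraicGeometry.Motives.SchemeOver ℂ), Literature.AlgebraicGeometry.Motives.IsSmoothHypersurface 6 4 X → ∀ (c : Literature.AlgebraicTopology.SingularHomology.singularCohomology ℂ ℂ (Literature.AlgebraicGeometry.Motives.ComplexPoints X) (2 * 3)), Literature.AlgebraicGeometry.HodgeTheory.IsRationalClass c → Literature.AlgebraicGeometry.HodgeTheory.IsOfHodgeType 6 X (2 * 3) 3 3 c → c ∈ Literature.AlgebraicGeometry.HodgeTheory.algebraicClasses X 3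

/-- item stmt-HodgeConjecture-1076 · crux · rank 5 · open · by planner
why it might fail: V ⇐ HC (CharlesSchnell Cor 11.3.6): false only with HC. As a work target it can stall: semiregularity needs semiregular lci representatives, BEK2014 is formal only, Perry's smoothness criterion is CY₂-only, DT₄ certificates need non-zero counts.
sources: CharlesSchnell2014Notes, Grothendieck1966, Bloch1972Semiregularity, BlochEsnaultKerz2014CharZero, Perry2022, arXiv:2208.09474
[crux] Grothendieck's VARIATIONAL HODGE CONJECTURE, global-class form on real carriers: f : 𝒳 ⟶ S a
smooth projective family of relative dimension n over a smooth irreducible ℂ-scheme S, A ∈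
H^{2p}(𝒳(ℂ);ℂ) with every fibre restriction A|_{𝒳_s} a rational (p,p) class; if A|_{𝒳_{s₀}} is
algebraic for one s₀ then for all s. Equivalent to CharlesSchnell2014Notes Conj. 11.3.1 (=
Grothendieck1966 footnote 13): a monodromy-invariant flat section of R^{2p}f_*ℚ is the restriction
of a class on the total space (theorem of the fixed part, Deligne Hodge II 4.1.1; Prop. 11.3.5), and
a flat family of Hodge classes becomes invariant after a finite étale base change. Known:
semiregular lci cycles (Bloch1972Semiregularity; BuchweitzFlenner2003 semiregularity map; Pridham
derived version), formal/infinitesimal part in char 0 (BlochEsnaultKerz2014CharZero: obstruction =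
Hodge condition; algebraization missing), p-adic analogue (BlochEsnaultKerz2014pAdic), standard
conjectures ⇒ V (André, via CharlesSchnell2014Notes remark after Thm 11.3.8), Weil classes along the
Weil locus in dim 4 (Markman2025SecantWeil). HC ⇒ V (Cor. 11.3.6). False over analytic
simply-connected bases (remark after Conj. 11.3.2) — -/
@[route_item "route-HodgeConjecture-KuznetsovCYFactory", crux]
def VariationalHodgeSmooth : Prop :=
  ∀ ⦃n : ℕ⦄ ⦃𝒳 S : Literature.AlgebraicGeometry.Motives.SchemeOver ℂ⦄ (f : 𝒳 ⟶ S), Literature.AlgebraicGeometry.Motives.IsSmoothProjectiveFamily f n → IrreducibleSpace S.left → AlgebraicGeometry.Smooth S.hom → ∀ (p : ℕ) (A : Literature.AlgebraicGeometry.HodgeTheory.complexBetti 𝒳 (2 * p)), (∀ s : Literature.AlgebraicGeometry.Motives.ComplexPoints S, Literature.AlgebraicGeometry.HodgeTheory.IsRationalClass (Literature.AlgebraicGeometry.HodgeTheory.complexBetti.map (Literature.AlgebraicGeometry.Motives.fiberι f s) (2 * p) A) ∧ Literature.AlgebraicGeometry.HodgeTheory.IsOfHodgeType n (Literature.AlgebraicGeometry.Motives.fiberOver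 f s) (2 * p) p p (Literature.AlgebraicGeometry.HodgeTheory.complexBetti.map (Literature.AlgebraicGeometry.Motives.fiberι f s) (2 * p) A)) → (∃ s₀ : Literature.AlgebraicGeometry.Motives.ComplexPoints S, Literature.AlgebraicGeometry.HodgeTheory.complexBetti.map (Literature.AlgebraicGeometry.Motives.fiberι f s₀) (2 * p) A ∈ Literature.AlgebraicGeometry.HodgeTheory.algebraicClasses (Literature.AlgebraicGeometry.Motives.fiberOver f s₀) p) → ∀ s : Literature.AlgebraicGeometry.Motives.ComplexPoints S, Literature.AlgebraicGeometry.HodgeTheory.complexBetti.map (Literature.AlgebraicGeometry.Motives.fiberι f s) (2 * p) A ∈ Literature.AlgebraicGeometry.HodgeTheory.algebraicClasses (Literature.AlgebraicGeometry.Motives.fiberOver f s) p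

/-- item stmt-HodgeConjecture-1077 · crux · rank 6 · open · by planner
why it might fail: An ⇐ HC (constant family), so ¬An ⇒ ¬HC; strategically it fails where a Hodge-locus component meets no Fermat/CM/linear-cycle/boundary member with algebraicity KNOWN — rigid (5,5)-classes on cubic tenfolds are such candidates; BKU2024: special points are sparse.
sources: CattaniDeligneKaplan1995JAMS, BaldiKlinglerUllmo2024, Shioda1979HodgeFermat, AljovinMovasatiVillaflor2019, Deligne1982HodgeCycles
[crux] ANCHOR EXISTENCE (geography of Hodge loci): every rational (p,p) class c on a smooth
projective X is, up to an iso X ≅ 𝒳_{s₁}, the restriction of a class A on the total space of a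
smooth projective family f : 𝒳 ⟶ S over a smooth irreducible base, with A fibrewise rational (p,p)
and A|_{𝒳_{s₀}} ALGEBRAIC at some s₀ — i.e. the connected algebraic deformation class of (X, c)
through Hodge classes (a component of the CDK Hodge locus, made invariant by finite base change)
contains a member where the class is known algebraic: Fermat/Delsarte members (Shioda1979HodgeFermat
inductive structure), CM points and Weil loci (Deligne1982HodgeCycles, Markman2025SecantWeil),
products, special cubic fourfolds (Zucker1977), degenerate/boundary members. Trivially true when c
is already algebraic (constant family). Counter-pressure: special points are sparse in level ≥ 3
(BaldiKlinglerUllmo2024). -/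
@[route_item "route-HodgeConjecture-KuznetsovCYFactory", crux]
def AnchorExistence : Prop :=
  ∀ ⦃n : ℕ⦄ ⦃X : Literature.AlgebraicGeometry.Motives.SchemeOver ℂ⦄, Literature.AlgebraicGeometry.Motives.IsSmoothProjective n X → ∀ (p : ℕ) (c : Literature.AlgebraicGeometry.HodgeTheory.complexBetti X (2 * p)), Literature.AlgebraicGeometry.HodgeTheory.IsRationalClass c → Literature.AlgebraicGeometry.HodgeTheory.IsOfHodgeType n X (2 * p) p p c → ∃ (𝒳 S : Literature.AlgebraicGeometry.Motives.SchemeOver ℂ) (f : 𝒳 ⟶ S) (s₁ s₀ : Literature.AlgebraicGeometry.Motives.ComplexPoints S) (e : X ≅ Literature.AlgebraicGeometry.Motives.fiberOver f s₁) (A : Literature.AlgebraicGeometry.HodgeTheory.complexBetti 𝒳 (2 * p)), Literature.AlgebraicGeometry.Motives.IsSmoothProjectiveFamily f n ∧ IrreducibleSpace S.left ∧ AlgebraicGeometry.Smooth S.hom ∧ (∀ s : Literature.AlgebraicGeometry.Motives.ComplexPoints S, Literature.AlgebraicGeometry.HodgeTheory.IsRationalClass (Literature.AlgebraicGeometry.HodgeTheory.complexBetti.map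 (Literature.AlgebraicGeometry.Motives.fiberι f s) (2 * p) A) ∧ Literature.AlgebraicGeometry.HodgeTheory.IsOfHodgeType n (Literature.AlgebraicGeometry.Motives.fiberOver f s) (2 * p) p p (Literature.AlgebraicGeometry.HodgeTheory.complexBetti.map (Literature.AlgebraicGeometry.Motives.fiberι f s) (2 * p) A)) ∧ Literature.AlgebraicGeometry.HodgeTheory.complexBetti.map e.hom (2 * p) (Literature.AlgebraicGeometry.HodgeTheory.complexBetti.map (Literature.AlgebraicGeometry.Motives.fiberι f s₁) (2 * p) A) = c ∧ Literature.AlgebraicGeometry.HodgeTheory.complexBetti.map (Literature.AlgebraicGeometry.Motives.fiberι f s₀) (2 * p) A ∈ Literature.AlgebraicGeometry.HodgeTheory.algebraicClasses (Literature.AlgebraicGeometry.Motives.fiberOver f s₀) p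

/-- item stmt-HodgeConjecture-1943 · crux · rank 9 · closed · proved by Summit.HodgeConjecture.HodgeConjecture.Theorems.nodalSupport_hodgeModels_proof @ 1b96015532b9 (prover) · by planner
why it might fail: A theorem (GAGA + de Rham + Hodge decomposition): false only AS STATED — HodgeModel bundles IsAnalytification, a ComplexDeRhamIsoFamily natural over ALL manifolds on the model space and an internal ⨁ H^{p,q}; one mis-specified field empties it. XL: exists_deRhamIsoFamily, isInternal_hodgePQ unbuilt.
sources: SerreGAGA1956, WellsDACM1980, VoisinHodgeI2002, Deligne2000, SGA1, lean: Literature.AlgebraicGeometry.HodgeTheory.nonempty_hodgeModel (HodgeTheory/HodgeModelExistence.lean:75)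
[support] needs-fact: Literature.AlgebraicGeometry.HodgeTheory.nonempty_hodgeModel (route-repair,
cone guardrail 2026-08-15). GENUINELY needed: `Nonempty (HodgeModel n X)` is conjunct 1 of
HodgeTheory.HodgeConjectureFor, i.e. part of the summit statement itself, so every route to
HodgeConjecture must produce it. This decl is VERBATIM the first antecedent of this route's Assembly
(and of NodalSupport's and QbarEnvelope's — re-ask this exact signature there to share the item); it
is filed as an item so that the closing chain is items-only (`Assembly_holds HodgeModels_holds
IsoInvariance_holds VariationalHodge_holds AnchorExistence_holds : HodgeConjecture` typechecks with
no unfolding; planner Sketch.lean rc 0, where `HodgeModels ↔ ∀ n X, IsSmoothProjective n X →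
Nonempty (HodgeModel n X)` is Iff.rfl) and so that the fact is named in the ledger as tier-0 debt of
the summit. HOW IT CLOSES: one line, `fun n X => nonempty_hodgeModel_holds`, once the Literature
fact is discharged — the reduction is already in tree:
HodgeModelExistenceDischarge.nonempty_hodgeModel_of_deRham_of_hodgeDecomposition (remaining leaves:
the real de Rham theorem exists_deRhamIsoFamily and the Hodge decomposition -/
@[route_item "route-HodgeConjecture-KuznetsovCYFactory", crux]
def HodgeModels : Prop :=
  ∀ (n : ℕ) (X : Literature.AlgebraicGeometry.Motives.SchemeOver ℂ), Literature.AlgebraicGeometry.HodgeTheory.nonempty_hodgeModel n X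

/-- `HodgeModels` holds: proved by `Summit.HodgeConjecture.HodgeConjecture.Theorems.nodalSupport_hodgeModels_proof` @ 1b96015532b9. -/
theorem HodgeModels_holds : HodgeModels := _root_.Summit.HodgeConjecture.HodgeConjecture.Theorems.nodalSupport_hodgeModels_proof

/-- item stmt-HodgeConjecture-16363 · support · rank 9 · open · by planner
[crux] PROMOTED NAMED FACT (route-choice repair 2026-08-16, harness-requested: the Literature fact
`HodgeTheory.deligne_globalInvariantCycles` was judged XL-apex — too large for one prover seat, and
non-crux facts are not split — after two discharge attempts bounced; it is load-bearing for crux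
#3's only live line). Deligne's global invariant cycle theorem / théorème de la partie fixe (Hodge
II Thm 4.1.1; Voisin II Thm 4.24; Charles–Schnell Thm 11.3.4), hard inclusion, ℂ-coefficients,
pointwise, on the real carriers of HodgeLocus.lean: for a smooth projective family f : 𝒳 ⟶ S of
relative dimension n over a smooth quasi-projective complex base (quasi-projectivity INLINED as ∃
open ℂ-immersion into a projective ℂ-scheme — Iff.rfl with HodgeTheory.IsQuasiProjectiveOver S — so
the route imports only HodgeLocus, never the fact file) and an open immersion i : 𝒳 ⟶ 𝒳̄ into a
smooth projective 𝒳̄, every continuous section σ of the étalé space FiberClass f k (a global =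
monodromy-invariant section of Rᵏ f_* ℂ) takes at each s₀ the value of the restriction of some A ∈
Hᵏ(𝒳̄(ℂ); ℂ): σ s₀ = globalSection f k (i^* A) s₀. VERBATIM the body of the named fact (planner
SketchIff.lean: Iff.rfl, lean -/
@[route_item "route-HodgeConjecture-KuznetsovCYFactory"]
def DeligneGlobalInvariantCycles : Prop :=
  ∀ (𝒳 Xbar S : Literature.AlgebraicGeometry.Motives.SchemeOver ℂ) (f : 𝒳 ⟶ S) (i : 𝒳 ⟶ Xbar) (n m : ℕ), Literature.AlgebraicGeometry.Motives.IsSmoothProjectiveFamily f n → (∃ (P : Literature.AlgebraicGeometry.Motives.SchemeOver ℂ) (j : S ⟶ P), Literature.AlgebraicGeometry.Motives.IsProjectiveOver P ∧ AlgebraicGeometry.IsOpenImmersion j.left) → AlgebraicGeometry.Smooth S.hom → Literature.AlgebraicGeometry.Motives.IsProjectiveOver Xbar → AlgebraicGeometry.SmoothOfRelativeDimension m Xbar.hom → AlgebraicGeometry.IsOpenImmersion i.left → ∀ (k : ℕ) (σ : Literature.AlgebraicGeometry.Motives.ComplexPoints S → Literature.AlgebraicGeometry.HodgeTheory.FiberClass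 f k), Continuous σ → (∀ s, (σ s).pt = s) → ∀ s₀ : Literature.AlgebraicGeometry.Motives.ComplexPoints S, ∃ A : Literature.AlgebraicGeometry.HodgeTheory.complexBetti Xbar k, σ s₀ = Literature.AlgebraicGeometry.HodgeTheory.globalSection f k (Literature.AlgebraicGeometry.HodgeTheory.complexBetti.map i k A) s₀

/-- item stmt-HodgeConjecture-1884 · support · rank 9 · closed · proved by Summit.HodgeConjecture.HodgeConjecture.Theorems.kuznetsovCYFactory_hypersurfaceOffMiddleHC_proof @ 488544ea04d5 (prover) · by planner
sources: VoisinHodgeII2003, VoisinHodgeI2002, Deligne2000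
[support] KNOWN (Lefschetz package): on a smooth hypersurface X ⊂ ℙ^{n+1} of dimension n every
rational (p,p)-class of degree 2p ≠ n is algebraic — weak Lefschetz (H^k(ℙ^{n+1}) → H^k(X(ℂ)) iso
for k < n) and Poincaré duality / hard Lefschetz (k > n) give H^{2p}(X, ℚ) = ℚ·hᵖ, and hᵖ is the
class of a codimension-p linear section ∈ algebraicClasses X p. Needs Literature facts not yet in
tree (Lefschetz hyperplane theorem for complex points of hypersurfaces, cycle class of linear
sections, Poincaré duality for X(ℂ)); dedup-friendly with every hypersurface route. Sources:
VoisinHodgeII2003 Thm 1.23 (Lefschetz hyperplane), VoisinHodgeI2002 §11.3, Deligne2000 §1. -/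
@[route_item "route-HodgeConjecture-KuznetsovCYFactory"]
def HypersurfaceOffMiddleHC : Prop :=
  ∀ (n d : ℕ) (X : Literature.AlgebraicGeometry.Motives.SchemeOver ℂ), Literature.AlgebraicGeometry.Motives.IsSmoothHypersurface n d X → ∀ (p : ℕ), 2 * p ≠ n → ∀ (c : Literature.AlgebraicTopology.SingularHomology.singularCohomology ℂ ℂ (Literature.AlgebraicGeometry.Motives.ComplexPoints X) (2 * p)), Literature.AlgebraicGeometry.HodgeTheory.IsRationalClass c → Literature.AlgebraicGeometry.HodgeTheory.IsOfHodgeType n X (2 * p) p p c → c ∈ Literature.AlgebraicGeometry.HodgeTheory.algebraicClasses X p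

-- `HypersurfaceOffMiddleHC` holds: proved by `Summit.HodgeConjecture.HodgeConjecture.Theorems.kuznetsovCYFactory_hypersurfaceOffMiddleHC_proof` @ 488544ea04d5 (its module imports this route file, so no `_holds` link can be stated here).

/-- item stmt-HodgeConjecture-1885 · support · rank 9 · closed · proved by Summit.HodgeConjecture.HodgeConjecture.Theorems.kuznetsovCYFactory_algebraicClassesIsoInvariant_proof @ 488544ea04d5 (prover) · by planner
sources: VoisinHodgeI2002
[support] API lemma (tree-internal): algebraicClasses (= supportedClasses, span of classes vanishing
off a Zariski-closed subset of codimension ≥ p) is carried to algebraicClasses by pull-back along an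
isomorphism e : X ≅ Y of ℂ-schemes (closed subsets and codimension correspond under e; restriction
to complements commutes with the induced homeomorphism AlgPoints.mapContinuous e.hom of complex
points). Glue for Assembly and CubicTenfoldHC. -/
@[route_item "route-HodgeConjecture-KuznetsovCYFactory"]
def AlgebraicClassesIsoInvariant : Prop :=
  ∀ (X Y : Literature.AlgebraicGeometry.Motives.SchemeOver ℂ) (e : X ≅ Y) (p : ℕ) (c : Literature.AlgebraicTopology.SingularHomology.singularCohomology ℂ ℂ (Literature.AlgebraicGeometry.Motives.ComplexPoints Y) (2 * p)), c ∈ Literature.AlgebraicGeometry.HodgeTheory.algebraicClasses Y p → Literature.AlgebraicTopology.SingularHomology.singularCohomology.map ℂ ℂ (Literature.AlgebraicGeometry.Motives.AlgPoints.mapContinuous (L := ℂ) e.hom) (2 * p) c ∈ Literature.AlgebraicGeometry.HodgeTheory.algebraicClasses X p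

-- `AlgebraicClassesIsoInvariant` holds: proved by `Summit.HodgeConjecture.HodgeConjecture.Theorems.kuznetsovCYFactory_algebraicClassesIsoInvariant_proof` @ 488544ea04d5 (its module imports this route file, so no `_holds` link can be stated here).

/-- item stmt-HodgeConjecture-1886 · support · rank 9 · closed · proved by Summit.HodgeConjecture.HodgeConjecture.Theorems.kuznetsovCYFactory_cubicTenfoldHC_proof @ 18ff869c8fb8 (prover) · by planner
sources: Perry2022
[support] GLUE, pure logic (proved as an `example` in the planner's Sketch.lean, lean check rc 0,
2026-08-15): nonempty_hodgeModel (named fact) → AlgebraicClassesIsoInvariant →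
HypersurfaceOffMiddleHC → CubicTenfoldTransport → CubicTenfoldAnchors → HC for every smooth cubic
tenfold (HodgeConjectureFor 10 X): split 2p = 10 (p = 5: anchors, transport from s₀ to s₁, pull back
along e) vs 2p ≠ 10 (off-middle). The route's first deliverable beyond the frame. -/
@[route_item "route-HodgeConjecture-KuznetsovCYFactory"]
def CubicTenfoldHC : Prop :=
  (∀ (n : ℕ) (X : Literature.AlgebraicGeometry.Motives.SchemeOver ℂ), Literature.AlgebraicGeometry.HodgeTheory.nonempty_hodgeModel n X) → AlgebraicClassesIsoInvariant → HypersurfaceOffMiddleHC → CubicTenfoldTransport → CubicTenfoldAnchors → ∀ (X : Literature.AlgebraicGeometry.Motives.SchemeOver ℂ), Literature.AlgebraicGeometry.Motives.IsSmoothHypersurface 10 3 X → Literature.AlgebraicGeometry.HodgeTheory.HodgeConjectureFor 10 X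

-- `CubicTenfoldHC` holds: proved by `Summit.HodgeConjecture.HodgeConjecture.Theorems.kuznetsovCYFactory_cubicTenfoldHC_proof` @ 18ff869c8fb8 (its module imports this route file, so no `_holds` link can be stated here).

/-- item stmt-HodgeConjecture-1887 · support · rank 9 · open · by planner
sources: Ran1980, Shioda1979HodgeFermat, Shioda1979PJA
[support] KNOWN (Ran1980 main theorem; Shioda1979HodgeFermat Thm IV with the Proc. Japan Acad. list:
prime degree, all n): the Hodge conjecture in every codimension for the Fermat hypersurface x₀^ℓ + …
+ x_{n+1}^ℓ = 0 of PRIME degree ℓ (Hodge classes spanned by classes of linear subspaces and their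
transforms). Real-vocabulary counterpart of the B-layer predicate
Literature.AlgebraicGeometry.Motives.ShiodaFermatStatement; the ANCHOR of CubicTenfoldAnchors at ℓ =
3 (and, with Shioda's m ≤ 20 clause, of the quartic stratum). IsSmoothProjective is an explicit
hypothesis because IsFermatVariety is set-theoretic. To be vendored as a Literature named fact (cite
item requested). -/
@[route_item "route-HodgeConjecture-KuznetsovCYFactory"]
def FermatPrimeDegreeHC : Prop :=
  ∀ (n ℓ : ℕ) (X : Literature.AlgebraicGeometry.Motives.SchemeOver ℂ), ℓ.Prime → Literature.AlgebraicGeometry.Motives.IsFermatVariety n ℓ X → Literature.AlgebraicGeometry.Motives.IsSmoothProjective n X → Literature.AlgebraicGeometry.HodgeTheory.HodgeConjectureFor n X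

-- earlier Assembly (stmt-HodgeConjecture-1880, replaced 2026-08-16T03:31:50Z -> stmt-HodgeConjecture-14552): retired by None — (∀ (n : ℕ) (X : Literature.AlgebraicGeometry.Motives.SchemeOver ℂ), Literature.AlgebraicGeometry.HodgeTheory.nonempty_hodgeModel n X) → AlgebraicClassesIsoInvariant → VariationalHodge → AnchorCompleteness → _root_.HodgeConjecture
/-- item stmt-HodgeConjecture-14552 · assembly · rank 1 · closed · proved by Summit.HodgeConjecture.HodgeConjecture.Theorems.kuznetsovCYFactory_assembly_proof @ ddd1ef193356 (prover) · by planner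
sources: Deligne2000, Perry2022
[assembly] HodgeModels → AlgebraicClassesIsoInvariant → VariationalHodgeSmooth → AnchorExistence →
HodgeConjecture: the chain of the deciding theorem `closes` (rev 5) recorded as an item — pure
logic, provable now by `fun hM hI hV hAn => closes hV hAn hI hM` (planner Sketch.lean rc 0,
2026-08-16): given X smooth projective and a rational (p,p)-class c, AnchorExistence gives (f, s₁,
s₀, e, A); VariationalHodgeSmooth transports algebraicity from the anchor fibre s₀ to s₁;
AlgebraicClassesIsoInvariant pulls it back along e : X ≅ 𝒳_{s₁}; e^*(A|s₁) = c; the anti-vacuity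
conjunct Nonempty (HodgeModel n X) is HodgeModels. Restated 2026-08-16 (route-choice repair) from
the old chain over the dropped own-phrasing targets VariationalHodge/AnchorCompleteness onto the
shared frame cruxes (AnchorTransport stmt-1076/1077). -/
@[route_item "route-HodgeConjecture-KuznetsovCYFactory"]
def Assembly : Prop :=
  HodgeModels → AlgebraicClassesIsoInvariant → VariationalHodgeSmooth → AnchorExistence → _root_.HodgeConjecture

-- `Assembly` holds: proved by `Summit.HodgeConjecture.HodgeConjecture.Theorems.kuznetsovCYFactory_assembly_proof` @ ddd1ef193356 (its module imports this route file, so no `_holds` link can be stated here).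

/-! D-0027 §2.1 — DECIDING THEOREM (planner-authored via `route open/edit --closes-file`; by planner-rbadge-HodgeConjecture-KuznetsovCYFact-838144cf-g3-0 2026-08-16T05:14:41Z):
its hypotheses are this route's items and its conclusion the sub-problem Statement (glue_lint), and it elaborates with this file. -/

@[closes "route-HodgeConjecture-KuznetsovCYFactory"] theorem closes (hV : VariationalHodgeSmooth) (hAn : AnchorExistence) (hM : HodgeModels) :
    _root_.HodgeConjecture := by
  -- Hypotheses = the route's CRUX items only: the two SHARED frame cruxes (AnchorTransport
  -- stmt-1076/1077) and HodgeModels (stmt-1943, crux rank 7: conjunct 1 `Nonempty (HodgeModel n X)`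
  -- of the summit statement = Literature fact nonempty_hodgeModel, tier-0 debt of every route).
  -- Iso-invariance of algebraicClasses is PROVED INLINE below (isomorphisms are open immersions, so
  -- codimension of points is preserved: Mathlib `coheight_eq_of_isOpenImmersion`; restriction to the
  -- complement commutes with pull-back: `complexBetti.restrictCompl_map_eq_zero`) — no support item,
  -- no FermatHypersurfaceReduction import.
  intro n X hX
  refine ⟨hM n X hX, fun p c hc hpp => ?_⟩
  -- anchor datum through (X, c): family f over a smooth irreducible base, X ≅ 𝒳_(s₁), anchor fibre s₀
  obtain ⟨𝒳, S, f, s₁, s₀, e, A, hf, hirr, hsm, hfib, hAc, hs₀⟩ := hAn hX p c hc hpp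
  -- transport algebraicity from the anchor fibre s₀ to s₁ (variational Hodge) …
  have h₁ := hV f hf hirr hsm p A hfib ⟨s₀, hs₀⟩ s₁
  -- … and across the isomorphism e : X ≅ 𝒳_(s₁): e^*(algebraicClasses 𝒳_(s₁) p) ⊆ algebraicClasses X p
  have h₂ : Literature.AlgebraicGeometry.HodgeTheory.complexBetti.map e.hom (2 * p)
      (Literature.AlgebraicGeometry.HodgeTheory.complexBetti.map
        (Literature.AlgebraicGeometry.Motives.fiberι f s₁) (2 * p) A) ∈
      Literature.AlgebraicGeometry.HodgeTheory.algebraicClasses X p := by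
    suffices h : Literature.AlgebraicGeometry.HodgeTheory.algebraicClasses
        (Literature.AlgebraicGeometry.Motives.fiberOver f s₁) p ≤
        (Literature.AlgebraicGeometry.HodgeTheory.algebraicClasses X p).comap
          (Literature.AlgebraicGeometry.HodgeTheory.complexBetti.map e.hom (2 * p)).hom from h h₁
    refine iSup_le fun Z ↦ iSup_le fun hZ ↦ iSup_le fun hp ↦ fun z hz ↦ ?_
    rw [LinearMap.mem_ker] at hz
    refine Literature.AlgebraicGeometry.HodgeTheory.mem_supportedClasses_of_restrictCompl_eq_zero
      (hZ.preimage e.hom.left.base.hom.continuous)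
      (fun w hw ↦ (hp _ hw).trans (AlgebraicGeometry.coheight_eq_of_isOpenImmersion e.hom.left).le) ?_
    exact Literature.AlgebraicGeometry.HodgeTheory.complexBetti.restrictCompl_map_eq_zero e.hom hz
  rw [hAc] at h₂
  exact h₂

end Summit.HodgeConjecture.HodgeConjecture.Theses.KuznetsovCYFactory
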